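import Summits.HodgeConjecture.CorCM.Census.CentralSquaresPartnersClasses
import Summits.HodgeConjecture.CorCM.Census.CentralSquaresPartnersIndirect

/-!
# The square-central class, LXI: THE MIXED MULTI-PARTNER LAW — dihedral partners of `T₀` and partners dihedral from one of them

COR-CM (cell `pub-hodgecm2`), count-neutral kernel combinatorics by the binder seat b09 (gen 50; lane SQUARE-CENTRAL CLASS, part LXI), assembling BY NAME part Iʼs
strict cover-closure law, part LXʼs residual closure with indirect partners (`residual_closure_partners_indirect_bpot`), and the relation families of parts LI,
LII, LV run in the frame of `T₀` (direct partners) and in the frame of a direct partner `T₁` (indirect partners; the cover is transported by part Vʼs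
`cover_frame`).  Theorems only: no definition, no `decide`, no certificate, no named fact, no `sorry`.  HONEST FRAMING: `HC_CM` is NOT proved, here or anywhere in
the tree; nothing here is a period or a headline.

**THE MIXED MULTI-PARTNER LAW (`isLeast_card_gfaces_generate_partners_mixed`).**  As the all-dihedral law (part LVI), but the partners of `T₀` come in two
kinds: DIRECT partners `T₁ ∈ 𝒯` (dihedral-type swap from `T₀`, transversals, ties, far partners — part LVIʼs data) and INDIRECT partners `T₂ ∈ 𝒯'`, each with
a direct partner `T₁` from which it is of dihedral type (a swap `Q` with `T₁·Q⁻¹ = T₂`, `Q² = 1`, preserving `T₁ ∖ T₂`, transversals inside `T₁ ∖ T₂` and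
`T₁ ∩ T₂`, ties and far partners in the frame of `T₁`).  Then **`μ(G, c) = φ₂(G, c)`**.  This is the shape of the rank-two affine block of Pauli `× E`
(D-capability graph the 4-cycle `T₀–T₁–T₂–T₃`: `T₁, T₃` direct, `T₂` indirect via `T₁`), `m ≥ 8`.

* §1 `pair_exchange_partners`: pairwise partner distances in the frame of a partner.
* §2 the law.

## References
* [Pohlmann1968] H. Pohlmann, Algebraic cycles on abelian varieties of complex multiplication type, Ann. of Math. 88 (1968), Thm 1.
* [Milne1999] J. S. Milne, Lefschetz motives and the Tate conjecture, Compositio Math. 117 (1999), Prop. 2.1, p. 54.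
-/

namespace Summit.HodgeConjecture.CorCM.Census.CentralSquares

open Finset
open scoped symmDiff
open Summit.HodgeConjecture.CorCM.Prior.AllgGroup.RfwfAllgGroup
open Summit.HodgeConjecture.CorCM.Census.BlockParity
open Summit.HodgeConjecture.CorCM.Census.Coinvariant
open Summit.HodgeConjecture.CorCM.Census.TwistGeneration
open Summit.HodgeConjecture.CorCM.Census.BaseBlock
open Summit.HodgeConjecture.CorCM.Census.CoverClosure

noncomputable section

variable {G : Type*} [Group G] [Fintype G] [DecidableEq G] (c : G)

/-! ## §1 Pairwise distances in the frame of a partner -/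

/-- **Pairwise partner distances in the exchanged frame**: the partners `insert T₀ (𝒯.erase T₁)` of `T₁` are pairwise at distance `2m`. [folklore] -/
theorem pair_exchange_partners (hc2 : c * c = 1) (T₀ : CMF G c) (𝒯 : Finset (CMF G c)) (m : ℕ)
    (hH : ∀ T₁ ∈ 𝒯, (T₀.1 \ T₁.1).card = 2 * m)
    (hpair : ∀ T₁ ∈ 𝒯, ∀ T₂ ∈ 𝒯, T₁ ≠ T₂ → ((T₀.1 \ T₁.1) ∆ (T₀.1 \ T₂.1)).card = 2 * m) (T₁ : CMF G c) :
    ∀ T ∈ insert T₀ (𝒯.erase T₁), ∀ T' ∈ insert T₀ (𝒯.erase T₁), T ≠ T' → ((T₁.1 \ T.1) ∆ (T₁.1 \ T'.1)).card = 2 * m := by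
  classical
  intro T hT T' hT' hne
  rw [← ddist_eq_card_symmDiff c T₁ hc2 T T']
  change (T.1 \ T'.1).card = 2 * m
  rcases mem_insert.mp hT with rfl | hTe <;> rcases mem_insert.mp hT' with h' | hT'e
  · exact absurd h'.symm hne
  · exact hH T' (mem_of_mem_erase hT'e)
  · subst h'; rw [card_sdiff_frame c hc2 T' T]; exact hH T (mem_of_mem_erase hTe)
  · have e : (T.1 \ T'.1).card = ddist T T' := rfl
    rw [e, ddist_eq_card_symmDiff c T₀ hc2 T T']
    exact hpair T (mem_of_mem_erase hTe) T' (mem_of_mem_erase hT'e) hne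

/-! ## §2 The mixed law -/

/-- **THE MIXED MULTI-PARTNER LAW.**  `G` a finite `2`-group, `c` a central involution `≠ 1`; `T₀` a base type (`|T₀| = 4m`, `m ≥ 3`) whose base changes are
`T₀`, `T̄₀`, the types of `𝒯 ∪ 𝒯'` and their complements (`𝒯 ≠ ∅`; all at distance `2m` from `T₀` and pairwise); every `T₁ ∈ 𝒯` a DIRECT dihedral-type partner
with part LVIʼs data; every `T₂ ∈ 𝒯'` an INDIRECT partner: of dihedral type from some `T₁ ∈ 𝒯`, with transversals, ties and far partners in the frame of `T₁`.
Then **`μ(G, c) = φ₂(G, c)`**. [folklore] -/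
theorem isLeast_card_gfaces_generate_partners_mixed (hG : IsPGroup 2 G) (hc2 : c * c = 1) (hc1 : c ≠ 1) (hcen : ∀ x : G, x * c = c * x)
    (T₀ : CMF G c) (𝒯 𝒯' : Finset (CMF G c)) (h𝒯 : 𝒯.Nonempty)
    (hbase : ∀ Q : G, rt c Q T₀ = T₀ ∨ rt c Q T₀ = rt c c T₀ ∨ ∃ T₁ ∈ 𝒯 ∪ 𝒯', rt c Q T₀ = T₁ ∨ rt c Q T₀ = rt c c T₁)
    (m : ℕ) (hm : 3 ≤ m) (hn : T₀.1.card = 4 * m) (hH : ∀ T₁ ∈ 𝒯 ∪ 𝒯', (T₀.1 \ T₁.1).card = 2 * m)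
    (hpair : ∀ T₁ ∈ 𝒯 ∪ 𝒯', ∀ T₂ ∈ 𝒯 ∪ 𝒯', T₁ ≠ T₂ → ((T₀.1 \ T₁.1) ∆ (T₀.1 \ T₂.1)).card = 2 * m)
    -- direct partners: part LVI's data
    (hframe : ∀ T₁ ∈ 𝒯, ∃ Q : G, ∃ T T' : Finset G,
      rt c Q T₀ = T₁ ∧ Q * Q = 1 ∧
      (∀ t ∈ T₀.1, ∀ t' ∈ T₀.1, (t' = t * Q ∨ t' = c * (t * Q)) → (t ∈ T₀.1 \ T₁.1 ↔ t' ∈ T₀.1 \ T₁.1)) ∧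
      (T ⊆ T₀.1 \ T₁.1 ∧ T.card = m ∧ ∀ t ∈ T₀.1 \ T₁.1, ∀ t' ∈ T₀.1, (t' = t * Q ∨ t' = c * (t * Q)) → (t ∈ T ↔ t' ∉ T)) ∧
      (T' ⊆ T₀.1 ∩ T₁.1 ∧ T'.card = m ∧ ∀ t ∈ T₀.1 ∩ T₁.1, ∀ t' ∈ T₀.1, (t' = t * Q ∨ t' = c * (t * Q)) → (t ∈ T' ↔ t' ∉ T')) ∧
      (∀ U : Finset G, U ⊆ T₀.1 \ T₁.1 → U.card = m →
        (∀ t ∈ T₀.1 \ T₁.1, ∀ t' ∈ T₀.1, (t' = t * Q ∨ t' = c * (t * Q)) → (t ∈ U ↔ t' ∉ U)) →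
        ∀ X : CMF G c, T₀.1 \ X.1 = U → ∀ Q' : G, ddist (rt c Q' T₀) X = m → rt c Q' T₀ = T₀ ∨ rt c Q' T₀ = T₁) ∧
      (∀ U' : Finset G, U' ⊆ T₀.1 ∩ T₁.1 → U'.card = m →
        (∀ t ∈ T₀.1 ∩ T₁.1, ∀ t' ∈ T₀.1, (t' = t * Q ∨ t' = c * (t * Q)) → (t ∈ U' ↔ t' ∉ U')) →
        ∀ X : CMF G c, T₀.1 \ X.1 = U' → ∀ Q' : G, ddist (rt c Q' T₀) X = m → rt c Q' T₀ = T₀ ∨ rt c Q' T₀ = rt c c T₁) ∧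
      (∀ a ∈ T₀.1 ∩ T₁.1, ∀ a' ∈ T₀.1, (a' = a * Q ∨ a' = c * (a * Q)) →
        (∀ T₂ ∈ 𝒯 ∪ 𝒯', T₂ ≠ T₁ → ∀ X : CMF G c, T₀.1 \ X.1 ⊆ T ∪ {a, a'} →
          (T₀.1 \ X.1).card < ddist T₂ X ∧ (T₀.1 \ X.1).card < ddist (rt c c T₂) X) ∧
        (∀ T₂ ∈ 𝒯 ∪ 𝒯', T₂ ≠ T₁ → ∀ X : CMF G c, T₁.1 \ X.1 ⊆ ((T₀.1 \ T₁.1) \ T).image (fun x => c * x) ∪ {a, a'} →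
          (T₁.1 \ X.1).card < ddist T₂ X ∧ (T₁.1 \ X.1).card < ddist (rt c c T₂) X)) ∧
      (∀ s ∈ T₀.1 \ T₁.1, ∀ s' ∈ T₀.1, (s' = s * Q ∨ s' = c * (s * Q)) →
        (∀ T₂ ∈ 𝒯 ∪ 𝒯', T₂ ≠ T₁ → ∀ X : CMF G c, T₀.1 \ X.1 ⊆ T' ∪ {s, s'} →
          (T₀.1 \ X.1).card < ddist T₂ X ∧ (T₀.1 \ X.1).card < ddist (rt c c T₂) X) ∧
        (∀ T₂ ∈ 𝒯 ∪ 𝒯', T₂ ≠ T₁ → ∀ X : CMF G c,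
          (rt c c T₁).1 \ X.1 ⊆ ((T₀.1 \ (rt c c T₁).1) \ T').image (fun x => c * x) ∪ {s, s'} →
          ((rt c c T₁).1 \ X.1).card < ddist T₂ X ∧ ((rt c c T₁).1 \ X.1).card < ddist (rt c c T₂) X)))
    -- indirect partners: dihedral from a direct partner, data in that partner's frame
    (hframe' : ∀ T₂ ∈ 𝒯', ∃ T₁ ∈ 𝒯, ∃ Q₁ Q : G, ∃ T T' : Finset G,
      rt c Q₁ T₀ = T₁ ∧ rt c Q T₁ = T₂ ∧ Q * Q = 1 ∧
      (∀ t ∈ T₁.1, ∀ t' ∈ T₁.1, (t' = t * Q ∨ t' = c * (t * Q)) → (t ∈ T₁.1 \ T₂.1 ↔ t' ∈ T₁.1 \ T₂.1)) ∧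
      (T ⊆ T₁.1 \ T₂.1 ∧ T.card = m ∧ ∀ t ∈ T₁.1 \ T₂.1, ∀ t' ∈ T₁.1, (t' = t * Q ∨ t' = c * (t * Q)) → (t ∈ T ↔ t' ∉ T)) ∧
      (T' ⊆ T₁.1 ∩ T₂.1 ∧ T'.card = m ∧ ∀ t ∈ T₁.1 ∩ T₂.1, ∀ t' ∈ T₁.1, (t' = t * Q ∨ t' = c * (t * Q)) → (t ∈ T' ↔ t' ∉ T')) ∧
      (∀ U : Finset G, U ⊆ T₁.1 \ T₂.1 → U.card = m →
        (∀ t ∈ T₁.1 \ T₂.1, ∀ t' ∈ T₁.1, (t' = t * Q ∨ t' = c * (t * Q)) → (t ∈ U ↔ t' ∉ U)) →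
        ∀ X : CMF G c, T₁.1 \ X.1 = U → ∀ Q' : G, ddist (rt c Q' T₁) X = m → rt c Q' T₁ = T₁ ∨ rt c Q' T₁ = T₂) ∧
      (∀ U' : Finset G, U' ⊆ T₁.1 ∩ T₂.1 → U'.card = m →
        (∀ t ∈ T₁.1 ∩ T₂.1, ∀ t' ∈ T₁.1, (t' = t * Q ∨ t' = c * (t * Q)) → (t ∈ U' ↔ t' ∉ U')) →
        ∀ X : CMF G c, T₁.1 \ X.1 = U' → ∀ Q' : G, ddist (rt c Q' T₁) X = m → rt c Q' T₁ = T₁ ∨ rt c Q' T₁ = rt c c T₂) ∧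
      (∀ a ∈ T₁.1 ∩ T₂.1, ∀ a' ∈ T₁.1, (a' = a * Q ∨ a' = c * (a * Q)) →
        (∀ T₃ ∈ insert T₀ ((𝒯 ∪ 𝒯').erase T₁), T₃ ≠ T₂ → ∀ X : CMF G c, T₁.1 \ X.1 ⊆ T ∪ {a, a'} →
          (T₁.1 \ X.1).card < ddist T₃ X ∧ (T₁.1 \ X.1).card < ddist (rt c c T₃) X) ∧
        (∀ T₃ ∈ insert T₀ ((𝒯 ∪ 𝒯').erase T₁), T₃ ≠ T₂ → ∀ X : CMF G c,
          T₂.1 \ X.1 ⊆ ((T₁.1 \ T₂.1) \ T).image (fun x => c * x) ∪ {a, a'} →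
          (T₂.1 \ X.1).card < ddist T₃ X ∧ (T₂.1 \ X.1).card < ddist (rt c c T₃) X)) ∧
      (∀ s ∈ T₁.1 \ T₂.1, ∀ s' ∈ T₁.1, (s' = s * Q ∨ s' = c * (s * Q)) →
        (∀ T₃ ∈ insert T₀ ((𝒯 ∪ 𝒯').erase T₁), T₃ ≠ T₂ → ∀ X : CMF G c, T₁.1 \ X.1 ⊆ T' ∪ {s, s'} →
          (T₁.1 \ X.1).card < ddist T₃ X ∧ (T₁.1 \ X.1).card < ddist (rt c c T₃) X) ∧
        (∀ T₃ ∈ insert T₀ ((𝒯 ∪ 𝒯').erase T₁), T₃ ≠ T₂ → ∀ X : CMF G c,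
          (rt c c T₂).1 \ X.1 ⊆ ((T₁.1 \ (rt c c T₂).1) \ T').image (fun x => c * x) ∪ {s, s'} →
          ((rt c c T₂).1 \ X.1).card < ddist T₃ X ∧ ((rt c c T₂).1 \ X.1).card < ddist (rt c c T₃) X))) :
    IsLeast {n : ℕ | ∃ S : Finset (CMF G c →₀ ℤ), (↑S ⊆ gfaceSet G c hc2) ∧ S.card = n ∧
      hodgeSpan c hc2 ≤ Submodule.span ℤ (pairSet c) ⊔ Submodule.span ℤ (translates c S)} (fibreTwo c hc2) := by
  classical
  refine isLeast_card_gfaces_generate_of_strict_cover_closure c T₀ hG hc2 hc1 hcen (1 + 1) fun S hS hlow => ?_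
  have hP : ∀ Ψ : CMF G c, pair c Ψ ∈ Submodule.span ℤ (pairSet c) ⊔ Submodule.span ℤ (translates c S) :=
    fun Ψ => Submodule.mem_sup_left (Submodule.subset_span (pair_mem_pairSet c Ψ))
  have hLrt : ∀ (Q' : G) (y : CMF G c →₀ ℤ), y ∈ Submodule.span ℤ (pairSet c) ⊔ Submodule.span ℤ (translates c S) →
      Finsupp.mapDomain (rt c Q') y ∈ Submodule.span ℤ (pairSet c) ⊔ Submodule.span ℤ (translates c S) :=
    fun Q' y hy => mapDomain_rt_mem_psp c hcen Q' S hy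
  have hcover : ∀ Ψ : CMF G c, 2 ≤ bpot c T₀ Ψ → ∃ Q₂ s s' : G, bpot c T₀ Ψ = ddist (rt c Q₂ T₀) Ψ ∧
      s ∈ (rt c Q₂ T₀).1 \ Ψ.1 ∧ s' ∈ (rt c Q₂ T₀).1 \ Ψ.1 ∧ s ≠ s' ∧
      gface c hc2 Ψ s s' ∈ Submodule.span ℤ (pairSet c) ⊔ Submodule.span ℤ (translates c S) ∧
      ((∃ Q₁ t t' : G, bpot c T₀ Ψ = ddist (rt c Q₁ T₀) Ψ ∧ t ∈ (rt c Q₁ T₀).1 \ Ψ.1 ∧ t' ∈ (rt c Q₁ T₀).1 \ Ψ.1 ∧ t ≠ t' ∧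
          (∀ Q' : G, ddist (rt c Q' T₀) (oflipCM c hc2 t Ψ) = bpot c T₀ (oflipCM c hc2 t Ψ) → rt c Q' T₀ = rt c Q₁ T₀) ∧
          (∀ Q' : G, ddist (rt c Q' T₀) (oflipCM c hc2 t' Ψ) = bpot c T₀ (oflipCM c hc2 t' Ψ) → rt c Q' T₀ = rt c Q₁ T₀) ∧
          (∀ Q' : G, ddist (rt c Q' T₀) (oflipCM c hc2 t (oflipCM c hc2 t' Ψ)) = bpot c T₀ (oflipCM c hc2 t (oflipCM c hc2 t' Ψ)) →
            rt c Q' T₀ = rt c Q₁ T₀)) →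
        (∀ Q' : G, ddist (rt c Q' T₀) (oflipCM c hc2 s Ψ) = bpot c T₀ (oflipCM c hc2 s Ψ) → rt c Q' T₀ = rt c Q₂ T₀) ∧
        (∀ Q' : G, ddist (rt c Q' T₀) (oflipCM c hc2 s' Ψ) = bpot c T₀ (oflipCM c hc2 s' Ψ) → rt c Q' T₀ = rt c Q₂ T₀) ∧
        (∀ Q' : G, ddist (rt c Q' T₀) (oflipCM c hc2 s (oflipCM c hc2 s' Ψ)) = bpot c T₀ (oflipCM c hc2 s (oflipCM c hc2 s' Ψ)) →
          rt c Q' T₀ = rt c Q₂ T₀)) := fun Ψ h2 => by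
    obtain ⟨Q₂, s, s', hQ₂, hs, hs', hss', hmem, hstr⟩ := hlow Ψ h2
    exact ⟨Q₂, s, s', hQ₂, hs, hs', hss', Submodule.mem_sup_right hmem, hstr⟩
  have hHc : ∀ T₁ ∈ 𝒯 ∪ 𝒯', (T₀.1 ∩ T₁.1).card = 2 * m := by
    intro T₁ hT₁
    have h0 := card_sdiff_add_card_inter T₀.1 T₁.1
    have h1 := hH T₁ hT₁
    omega
  have h𝒯sub : ∀ T₁ ∈ 𝒯, T₁ ∈ 𝒯 ∪ 𝒯' := fun T₁ h => mem_union_left _ h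
  refine residual_closure_partners_indirect_bpot c hc2 hc1 hcen T₀ 𝒯 𝒯' h𝒯 hbase _ hP 1 m (fun T₁ h => hH T₁ (h𝒯sub T₁ h))
    (fun T₁ h => hHc T₁ (h𝒯sub T₁ h)) ?_ ?_ ?_ ?_ ?_
  · -- direct `2Y_s`
    intro T₁ hT₁ s hs
    obtain ⟨Q, T, T', hQ, hQQ, hσH, ⟨hTH, hTm, hT⟩, ⟨hTH', hTm', hT'⟩, hties, htiesC, hfarT, hfarT'⟩ := hframe T₁ hT₁
    rw [pow_one]
    exact two_smul_Y_mem_partners c hc2 hcen T₀ (𝒯 ∪ 𝒯') hbase m hn hH hpair T₁ (h𝒯sub T₁ hT₁) Q hQ hQQ hσH _ hLrt hP hcover hties htiesC hm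
      T hTH hTm hT T' hTH' hTm' hT' hfarT' s hs
  · -- direct `2Y'_a`
    intro T₁ hT₁ a ha
    obtain ⟨Q, T, T', hQ, hQQ, hσH, ⟨hTH, hTm, hT⟩, ⟨hTH', hTm', hT'⟩, hties, htiesC, hfarT, hfarT'⟩ := hframe T₁ hT₁
    rw [pow_one]
    exact two_smul_Y'_mem_partners c hc2 hcen T₀ (𝒯 ∪ 𝒯') hbase m hn hH hpair T₁ (h𝒯sub T₁ hT₁) Q hQ hQQ hσH _ hLrt hP hcover hties htiesC hm
      T hTH hTm hT T' hTH' hTm' hT' hfarT a ha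
  · -- direct `R(T)`
    intro T₁ hT₁
    obtain ⟨Q, T, T', hQ, hQQ, hσH, ⟨hTH, hTm, hT⟩, ⟨hTH', hTm', hT'⟩, hties, htiesC, hfarT, hfarT'⟩ := hframe T₁ hT₁
    exact ⟨T, hTH, hTm, rel_transversal_mem_partners c hc2 hcen T₀ (𝒯 ∪ 𝒯') hbase m hn hH hpair T₁ (h𝒯sub T₁ hT₁) Q hQ hQQ _ hLrt hcover
      (by omega) hσH T hTH hTm hT (hties T hTH hTm hT)⟩
  · -- direct `Rᶜ(T')`
    intro T₁ hT₁
    obtain ⟨Q, T, T', hQ, hQQ, hσH, ⟨hTH, hTm, hT⟩, ⟨hTH', hTm', hT'⟩, hties, htiesC, hfarT, hfarT'⟩ := hframe T₁ hT₁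
    exact relc_mem_partners c hc2 hcen T₀ (𝒯 ∪ 𝒯') hbase m hn hH hpair T₁ (h𝒯sub T₁ hT₁) Q hQ hQQ hσH _ hLrt hcover htiesC hP (by omega)
      ⟨T', hTH', hTm', hT'⟩
  · -- indirect partners, in the frame of their direct partner
    intro T₂ hT₂
    obtain ⟨T₁, hT₁, Q₁, Q, T, T', hQ₁, hQ, hQQ, hσH, ⟨hTH, hTm, hT⟩, ⟨hTH', hTm', hT'⟩, hties, htiesC, hfarT, hfarT'⟩ := hframe' T₂ hT₂
    have hT₁u : T₁ ∈ 𝒯 ∪ 𝒯' := h𝒯sub T₁ hT₁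
    -- the frame of `T₁`
    have hbase₁ := hbase_exchange_partners c hbase hQ₁
    have hn₁ : T₁.1.card = 4 * m := card_frame c hc2 T₀ T₁ m hn
    have hH₁ := card_sdiff_exchange_partners c hc2 T₀ (𝒯 ∪ 𝒯') m hH hpair hT₁u
    have hpair₁ := pair_exchange_partners c hc2 T₀ (𝒯 ∪ 𝒯') m hH hpair T₁
    have hcov₁ := cover_frame c hc2 T₀ (Submodule.span ℤ (pairSet c) ⊔ Submodule.span ℤ (translates c S)) Q₁ hcover
    simp only [hQ₁] at hcov₁
    have hH₁₂ : (T₁.1 \ T₂.1).card = 2 * m := by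
      have e : (T₁.1 \ T₂.1).card = ddist T₁ T₂ := rfl
      by_cases h12 : T₁ = T₂
      · exfalso
        -- `T₂ = T₁` would make the swap fix `T₁`: then `T₁ ∖ T₂ = ∅` has no transversal of size `m ≥ 3`
        subst h12
        have h0 : (T₁.1 \ T₁.1).card = 0 := by rw [Finset.sdiff_self, card_empty]
        have h1 := card_le_card hTH
        omega
      · rw [e, ddist_eq_card_symmDiff c T₀ hc2 T₁ T₂]
        exact hpair T₁ hT₁u T₂ (mem_union_right _ hT₂) h12
    have h12 : T₂ ≠ T₁ := by
      intro h; rw [h, Finset.sdiff_self, card_empty] at hH₁₂; omega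
    have hT₂' : T₂ ∈ insert T₀ ((𝒯 ∪ 𝒯').erase T₁) := mem_insert_of_mem (mem_erase.mpr ⟨h12, mem_union_right _ hT₂⟩)
    have hHc₁₂ : (T₁.1 ∩ T₂.1).card = 2 * m := by
      have h0 := card_sdiff_add_card_inter T₁.1 T₂.1
      omega
    refine ⟨T₁, hT₁, hH₁₂, hHc₁₂, ?_, ?_, ?_, ?_⟩
    · intro s hs
      rw [pow_one]
      exact two_smul_Y_mem_partners c hc2 hcen T₁ _ hbase₁ m hn₁ hH₁ hpair₁ T₂ hT₂' Q hQ hQQ hσH _ hLrt hP hcov₁ hties htiesC hm T hTH hTm hT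
        T' hTH' hTm' hT' hfarT' s hs
    · intro a ha
      rw [pow_one]
      exact two_smul_Y'_mem_partners c hc2 hcen T₁ _ hbase₁ m hn₁ hH₁ hpair₁ T₂ hT₂' Q hQ hQQ hσH _ hLrt hP hcov₁ hties htiesC hm T hTH hTm hT
        T' hTH' hTm' hT' hfarT a ha
    · exact ⟨T, hTH, hTm, rel_transversal_mem_partners c hc2 hcen T₁ _ hbase₁ m hn₁ hH₁ hpair₁ T₂ hT₂' Q hQ hQQ _ hLrt hcov₁ (by omega) hσH
        T hTH hTm hT (hties T hTH hTm hT)⟩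
    · exact relc_mem_partners c hc2 hcen T₁ _ hbase₁ m hn₁ hH₁ hpair₁ T₂ hT₂' Q hQ hQQ hσH _ hLrt hcov₁ htiesC hP (by omega) ⟨T', hTH', hTm', hT'⟩

end

end Summit.HodgeConjecture.CorCM.Census.CentralSquares
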